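import Summits.HodgeConjecture.HodgeConjecture.Theorems.PadicSemiregularLiftHodgeFermatVarietiesExistsFibreOfNotPairedGeneral
import Summits.HodgeConjecture.HodgeConjecture.Theorems.PadicSemiregularLiftHodgeFermatVarietiesSigmaStdOfFibre
import Summits.HodgeConjecture.HodgeConjecture.Theorems.PadicSemiregularLiftHodgeFermatVarietiesReachStd
import Summits.HodgeConjecture.HodgeConjecture.Theorems.PadicSemiregularLiftHodgeFermatVarietiesCoprimeSixPayoff
import HarnessLib

/-!
# Aoki's Theorem A one prime down and HC for the Fermat `(p−1)`-folds `X^{p−1}ₘ` of least prime `p` — stub GP `stub_coprimeClassification_general` of line `cancel-by-any-claim-lattice`, crux `HodgeFermatVarieties` (stmt-HodgeConjecture-1334)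

Crux `HodgeFermatVarieties` (stmt-HodgeConjecture-1334), line `cancel-by-any-claim-lattice`, stub GP
`stub_coprimeClassification_general` (the assembled classification of the lead's programme GP, "Aoki's
Theorem A one prime down, for every prime `p ≥ 5` at once", lead c4) together with its importable
Hodge-conjecture pay-off. Everything here is PROVED (no `sorry`, no new definition, no new named fact):
the file only assembles the four LANDED pieces of the programme,

* `PairedNull.stub_exists_fibre_of_not_paired_general` (`…ExistsFibreOfNotPairedGeneral`, GP-L2: for a
  prime `p₁ ≥ 5`, a non-paired Hodge `(p₁+1)`-multiset at a level `m` all of whose prime factors are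
  `≥ p₁`, `p₁² ∤ m`, `p₁(p₁+2) ∤ m`, contains all but one of the `p₁` points of a progression
  `{A + j(m/p₁)}` with `p₁A ≠ 0`, and `p₁ ∣ m`),
* `CoprimeSix.stub_sigmaStd_of_fibre` (`…SigmaStdOfFibre`, GP-L3: `p₁ - 1` progression points force
  pairs or Aoki's `σ_{p₁,A} = {A + j(m/p₁) : j < p₁} + {-p₁A}`),
* `CoprimeSix.stub_reach_of_pairedOrSigmaStd` (`…ReachStd`, GP-R: both shapes are ℤ-reachable from the
  printed supply at their own level; and `coprime_six_of_le_of_mem_primeFactors`),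
* `CoprimeSix.exists_pairs_of_count_symm` (`…CoprimeSixPayoff`: symmetric multiplicities at a level
  prime to `6` split a Hodge multiset into pairs `Q + (-Q)`, `Q` zero-free),

into:

* `stub_coprimeClassification_general` (registered signature) and its named-hypotheses form
  `classification_general` — **AOKI'S THEOREM A ONE PRIME DOWN: for a prime `p ≥ 5` and a level `m` all
  of whose prime factors are `≥ p`, `p² ∤ m`, `p(p+2) ∤ m`, every Hodge `(p+1)`-multiset of `ℤ/m` is a
  juxtaposition of pairs `{a, -a}` (`a ≠ 0`), or `p ∣ m` and it is Aoki's standard element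
  `σ_{p,A} = {A + j(m/p) : j < p} + {-pA}` with `pA ≠ 0`** (symmetric multiplicities: pairs, `m` being
  prime to `6` as all its primes are `≥ 5`; otherwise GP-L2 then GP-L3);
* `reach_general` — hence every Hodge `(p+1)`-multiset of such a level is reachable at its own level
  (GP-R);
* `allUnit_paired_general` — a Hodge `(p+1)`-multiset of UNITS at such a level is pairs (the entry `-pA`
  of `σ_{p,A}` is never a unit when `p ∣ m`): Aoki's Thm A′ for `(p+1)`-tuples of units one prime below
  its printed range `minFac m > p`;
* `hodgeConjectureFor_general` — **HC FOR EVERY SMOOTH PROJECTIVE COMPLEX FERMAT `(p−1)`-FOLD `X^{p−1}ₘ`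
  OF A DEGREE `m` WITH LEAST PRIME FACTOR `≥ p`, `p² ∤ m`, `p(p+2) ∤ m`** (`p ≥ 5` prime), granted
  exactly the hypotheses of every earlier pay-off of the line: the printed facts S0 (Aoki 1987
  Thm 1-4 (i),(ii), Thm 1-1, Thm 2-1; Aoki–Shioda 1983 (2.1)) and the statements of the stubs S2↑/S2↓
  (claim along level raising), S3a (Shioda's semi-decomposable supply) and S5 (eigenspace structure,
  Ran Prop. 1.7), spelled verbatim as in `…DoublingHodge` / `…CoprimeSixPayoff`. Writing `p = 2r + 1`,
  every Hodge character of `X²ʳₘ` has `2r + 2 = p + 1` entries, so its value multiset is reachable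
  (`reach_general`), hence claimed (`Doubling.claimMultiset_of_stableReach`: the lattice criterion S1
  over the printed supply S3b), and the per-dimension transfer `hodgeConjectureFor_of_claims_dim` at
  `(m, r)` applies.

Instances: `p = 5` — the fourfolds `X⁴ₘ`, `(m, 6) = 1`, `25 ∤ m`, `35 ∤ m` (S16,
`hodgeConjectureFor_fourfold_coprime_six`, da Silva 2021 Thm 3.3 with its unstated classification);
`p = 7` — the sixfolds `X⁶ₘ`, `(m, 30) = 1`, `49 ∤ m` (G8; `63 ∤ m` is automatic); `p = 11` —
HC(`X¹⁰ₘ`) for `minFac m ≥ 11`, `121 ∤ m`, `143 ∤ m`; …. This is Aoki 1983 Thm A′ (`𝔅ⁿₘ = 𝔇ⁿₘ`: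
every Hodge `(n+2)`-tuple of `ℤ/m` is paired when all primes of `m` exceed `n + 1`) ONE PRIME DOWN —
at `minFac m = p = n + 1` the single new shape is `σ_{p,A}`, whose eigenlines are algebraic by
Aoki 1987 Thm 2-1 (the explicit standard subvarieties) — now SUPPLIED for `p² ∤ m`, `p(p+2) ∤ m`,
modulo the printed facts S0 and the stub statements S2/S3a/S5. The two excluded cores (`p² ∣ m`:
fibres of `p` units; `p(p+2) ∣ m`: the twin prime at the boundary of the room) are NOT treated here;
the engine S4 is not used; an all-`n` wrapper is deliberately NOT here.

References: [Aoki1983] N. Aoki, Math. Ann. 266 (1983) Thm. A′ (§7); [Aoki1987] N. Aoki, J. Math. Soc.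
Japan 39 (1987) §1 p. 386–387, Thm. 1-1, Thm. 1-4, Thm. 2-1 (p. 388); [Shioda1979PJA] T. Shioda, Proc.
Japan Acad. 55A (1979) §2 Thm. 1; [Ran1980] Z. Ran, Compositio Math. 42 (1980) Prop. 1.7;
[daSilva2021HodgeFermat] G. da Silva Jr., arXiv:2101.04739, Thm. 3.3.
-/

-- every sibling file of the line declares into `…CancelByAnyClaimLattice.CoprimeSix` from a differently named module
set_option linter.dupNamespace false

noncomputable section

open Finset
open CategoryTheory AlgebraicGeometry
open Literature.AlgebraicGeometry Literature.AlgebraicGeometry.Motives Literature.AlgebraicTopology.SingularHomology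
open Literature.AlgebraicGeometry.HodgeTheory Literature.AlgebraicGeometry.HodgeTheory.FermatCharacter

namespace Summit.HodgeConjecture.HodgeConjecture.Theorems.CancelByAnyClaimLattice.CoprimeSix

/-- `Supply[M]` — the printed supply of level `M` (local notation of the line, verbatim). -/
local notation3 (prettyPrint := false) "Supply[" M "]" =>
  ({s : Multiset (ZMod M) | ∃ a : ZMod M, a ≠ 0 ∧ s = ({a, -a} : Multiset (ZMod M))} ∪
    {s : Multiset (ZMod M) | IsHodgeMultiset s ∧ Multiset.card s = 4} ∪
    {s : Multiset (ZMod M) | IsHodgeMultiset s ∧ IsSemiDecomposable s} ∪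
    {s : Multiset (ZMod M) | ∃ (p : ℕ) (a : ZMod M), p.Prime ∧ p ≠ 2 ∧ p ∣ M ∧
        2 < (M / p) / Nat.gcd (ZMod.val a) (M / p) ∧
        s = Multiset.map (fun j : ℕ => a + (j : ZMod M) * ((M / p : ℕ) : ZMod M)) (Multiset.range p) +
              {-((p : ZMod M) * a)}} : Set (Multiset (ZMod M)))

/-- `Reach[M, s]` (local notation of the line, verbatim). -/
local notation3 (prettyPrint := false) "Reach[" M ", " s "]" =>
  ∃ P N : Multiset (Multiset (ZMod M)),
    (∀ u ∈ P, u ∈ Supply[M]) ∧ (∀ u ∈ N, u ∈ Supply[M]) ∧ s + Multiset.sum N = Multiset.sum P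

/-- `LevelRaise[k, m, s]` (local notation of the line, verbatim). -/
local notation3 (prettyPrint := false) "LevelRaise[" k ", " m ", " s "]" =>
  Multiset.map (fun a : ZMod m => ((k * ZMod.val a : ℕ) : ZMod (k * m))) s

/-- `StableReach[m, s]` (local notation of the line, verbatim). -/
local notation3 (prettyPrint := false) "StableReach[" m ", " s "]" => ∃ k : ℕ, 0 < k ∧ Reach[k * m, LevelRaise[k, m, s]]

/-- The statement of stub S2↑ (pull-back of claim along level raising). Local notation only, verbatim
`…DoublingHodge`. -/
local notation3 (prettyPrint := false) "LevelClaimPull" =>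
  ∀ (m k r : ℕ) (α' : Fin (2 * r + 2) → ZMod m), 0 < k → (∀ i, α' i ≠ 0) →
    FermatCharacter.Claim m r α' → FermatCharacter.Claim (k * m) r (fun i => ((k * (α' i).val : ℕ) : ZMod (k * m)))

/-- The statement of stub S2↓ (push-forward of claim along level raising). Local notation only, verbatim
`…DoublingHodge`. -/
local notation3 (prettyPrint := false) "LevelClaimPush" =>
  ∀ (m k r : ℕ) (α' : Fin (2 * r + 2) → ZMod m), 0 < k → (∀ i, α' i ≠ 0) →
    FermatCharacter.Claim (k * m) r (fun i => ((k * (α' i).val : ℕ) : ZMod (k * m))) → FermatCharacter.Claim m r α'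

/-- The statement of stub S3a (Shioda's semi-decomposable supply is claimed). Local notation only, verbatim
`…DoublingHodge`. -/
local notation3 (prettyPrint := false) "SemiClaim" =>
  ∀ (M : ℕ) [NeZero M] (s : Multiset (ZMod M)), IsHodgeMultiset s → IsSemiDecomposable s → ClaimMultiset M s

/-- The statement of stub S5 (eigenspace structure of `H²ᵖ(X²ᵖₘ)`, Ran Prop. 1.7) at every level. Local
notation only, verbatim `…DoublingHodge`. -/
local notation3 (prettyPrint := false) "EigenStructure" =>
  ∀ (m : ℕ) [NeZero m] ⦃p : ℕ⦄, 0 < p →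
    (∀ α : Fin (2 * p + 2) → ZMod m, α ≠ 0 → (∃ i, α i = 0) → fermatEigenspace m α (2 * p) = ⊥) ∧
    (fermatEigenspace m (0 : Fin (2 * p + 2) → ZMod m) (2 * p) ≤
      LinearMap.range (complexBetti.map (SmoothHypersurface.hypersurfaceι (fermatPolynomial ℂ (2 * p) m)) (2 * p)).hom) ∧
    (∀ (A : HodgeModel (2 * p) (fermatHypersurface (2 * p) m)) (β : Fin (2 * p + 2) → ZMod m),
      (∀ i, β i ≠ 0) →
      (∃ x ∈ fermatEigenspace m β (2 * p), x ≠ 0 ∧ A.pullback (2 * p) x ∈ A.hodgePQ (2 * p) p p) →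
        2 * FermatCharacter.normSum β = m * (2 * p + 2))

/-! ### §1 GP: the classification of the Hodge `(p+1)`-multisets at a level of least prime `≥ p` -/

section Classification

/-- **GP `stub_coprimeClassification_general` — AOKI'S THEOREM A ONE PRIME DOWN**: for a prime `p₁ ≥ 5`
and a level `m` all of whose prime factors are `≥ p₁`, with `p₁² ∤ m` and `p₁(p₁+2) ∤ m`, every Hodge
`(p₁+1)`-multiset `s` of `ℤ/m` is a juxtaposition of pairs `{a, -a}` (`a ≠ 0`), or `p₁ ∣ m` and
`s = σ_{p₁,A} = {A + j(m/p₁) : j < p₁} + {-p₁A}` with `p₁A ≠ 0` (registered signature of line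
`cancel-by-any-claim-lattice`). The level is prime to `6` (`coprime_six_of_le_of_mem_primeFactors`); if
every residue occurs in `s` as often as its negative, `s` is pairs (`exists_pairs_of_count_symm`);
otherwise the level analysis GP-L2 (`PairedNull.stub_exists_fibre_of_not_paired_general`) gives `p₁ ∣ m`
and all but one of the `p₁` points `A + j(m/p₁)` inside `s` with `p₁A ≠ 0`, and GP-L3
(`stub_sigmaStd_of_fibre`) forces pairs or `s = σ_{p₁,A}`. [cite: Aoki1983, Thm. A′ (§7)]
[cite: Aoki1987, Thm. 2-1 (p. 388)] -/
theorem stub_coprimeClassification_general : ∀ (p₁ : ℕ), p₁.Prime → 5 ≤ p₁ → ∀ (m : ℕ) [NeZero m], (∀ q ∈ m.primeFactors, p₁ ≤ q) → ¬ p₁ * p₁ ∣ m → ¬ p₁ * (p₁ + 2) ∣ m → ∀ s : Multiset (ZMod m), IsHodgeMultiset s → Multiset.card s = p₁ + 1 → (∃ Q : Multiset (ZMod m), (∀ a ∈ Q, a ≠ 0) ∧ s = Q + Q.map (fun a ↦ -a)) ∨ (p₁ ∣ m ∧ ∃ A : ZMod m, (p₁ : ZMod m) * A ≠ 0 ∧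 s = (Multiset.range p₁).map (fun i : ℕ ↦ A + (i : ZMod m) * ((m / p₁ : ℕ) : ZMod m)) + {-((p₁ : ZMod m) * A)}) := by
  -- adapted from the lead's skeleton (generation 13b, programme GP)
  intro p₁ hp₁ hp₁5 m _ hmin hsq htwin s hs hR
  have hm6 : m.Coprime 6 := coprime_six_of_le_of_mem_primeFactors hp₁5 hmin
  by_cases hsym : ∀ x : ZMod m, Multiset.count x s = Multiset.count (-x) s
  · exact Or.inl (exists_pairs_of_count_symm hm6 _ s rfl hs hsym)
  · push Not at hsym
    obtain ⟨hp, A, hA, hfib⟩ :=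
      PairedNull.stub_exists_fibre_of_not_paired_general p₁ hp₁ hp₁5 m hmin hsq htwin s hs hR hsym
    rcases stub_sigmaStd_of_fibre p₁ hp₁ hp₁5 m hmin hp s hs hR A hA hfib with h | h
    · exact Or.inl h
    · exact Or.inr ⟨hp, A, hA, h⟩

variable {p₁ : ℕ} {m : ℕ} [NeZero m]

/-- **The classification of the Hodge `(p₁+1)`-multisets at a level of least prime `≥ p₁` (`p₁ ≥ 5`
prime, `p₁² ∤ m`, `p₁(p₁+2) ∤ m`), named hypotheses**: pairs, or `p₁ ∣ m` and `σ_{p₁,A}` with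
`p₁A ≠ 0` (`stub_coprimeClassification_general`). [cite: Aoki1983, Thm. A′ (§7)]
[cite: Aoki1987, Thm. 2-1 (p. 388)] -/
theorem classification_general (hp₁ : p₁.Prime) (hp₁5 : 5 ≤ p₁) (hmin : ∀ q ∈ m.primeFactors, p₁ ≤ q)
    (hsq : ¬ p₁ * p₁ ∣ m) (htwin : ¬ p₁ * (p₁ + 2) ∣ m) {s : Multiset (ZMod m)} (hs : IsHodgeMultiset s)
    (hR : Multiset.card s = p₁ + 1) :
    (∃ Q : Multiset (ZMod m), (∀ a ∈ Q, a ≠ 0) ∧ s = Q + Q.map (fun a ↦ -a)) ∨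
      (p₁ ∣ m ∧ ∃ A : ZMod m, (p₁ : ZMod m) * A ≠ 0 ∧
        s = (Multiset.range p₁).map (fun i : ℕ ↦ A + (i : ZMod m) * ((m / p₁ : ℕ) : ZMod m)) +
          {-((p₁ : ZMod m) * A)}) :=
  stub_coprimeClassification_general p₁ hp₁ hp₁5 m hmin hsq htwin s hs hR

/-- **Every Hodge `(p₁+1)`-multiset at a level `m` of least prime `≥ p₁` (`p₁ ≥ 5` prime, `p₁² ∤ m`,
`p₁(p₁+2) ∤ m`) is ℤ-reachable from the printed supply at its own level**: by the classification it is
pairs or `σ_{p₁,A}`, and both shapes are reachable (`stub_reach_of_pairedOrSigmaStd`: pairs are the first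
component of the supply, `σ_{p₁,A}` the fourth with `p = p₁`). [cite: Aoki1987, Thm. 1-1 and Thm. 2-1 (p. 388)]
[cite: Aoki1983, Thm. A′ (§7)] -/
theorem reach_general (hp₁ : p₁.Prime) (hp₁5 : 5 ≤ p₁) (hmin : ∀ q ∈ m.primeFactors, p₁ ≤ q)
    (hsq : ¬ p₁ * p₁ ∣ m) (htwin : ¬ p₁ * (p₁ + 2) ∣ m) {s : Multiset (ZMod m)} (hs : IsHodgeMultiset s)
    (hR : Multiset.card s = p₁ + 1) : Reach[m, s] :=
  stub_reach_of_pairedOrSigmaStd p₁ hp₁ hp₁5 m hmin s hs hR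
    (stub_coprimeClassification_general p₁ hp₁ hp₁5 m hmin hsq htwin s hs hR)

/-- **A Hodge `(p₁+1)`-multiset of UNITS at a level `m` of least prime `≥ p₁` (`p₁ ≥ 5` prime, `p₁² ∤ m`,
`p₁(p₁+2) ∤ m`) is a juxtaposition of pairs**: in the other branch of the classification `p₁ ∣ m` and the
entry `-p₁A` of `s = σ_{p₁,A}` would be a unit, making the prime `p₁` a unit modulo `m` — impossible.
(Aoki's Thm A′ for `(p₁+1)`-tuples of units one prime below its printed range `minFac m > p₁`.)
[cite: Aoki1983, Thm. A′ (§7)] -/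
theorem allUnit_paired_general (hp₁ : p₁.Prime) (hp₁5 : 5 ≤ p₁) (hmin : ∀ q ∈ m.primeFactors, p₁ ≤ q)
    (hsq : ¬ p₁ * p₁ ∣ m) (htwin : ¬ p₁ * (p₁ + 2) ∣ m) {s : Multiset (ZMod m)} (hs : IsHodgeMultiset s)
    (hR : Multiset.card s = p₁ + 1) (hu : ∀ x ∈ s, IsUnit x) :
    ∃ Q : Multiset (ZMod m), (∀ a ∈ Q, a ≠ 0) ∧ s = Q + Q.map (fun a ↦ -a) := by
  rcases stub_coprimeClassification_general p₁ hp₁ hp₁5 m hmin hsq htwin s hs hR with h | ⟨hp, A, _, hsA⟩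
  · exact h
  · exfalso
    have hmem : -((p₁ : ZMod m) * A) ∈ s := by
      rw [hsA]
      exact Multiset.mem_add.2 (Or.inr (Multiset.mem_singleton_self _))
    have hpu : IsUnit ((p₁ : ℕ) : ZMod m) :=
      isUnit_of_mul_isUnit_left ((IsUnit.neg_iff _).1 (hu _ hmem))
    exact (ZMod.isUnit_prime_iff_not_dvd hp₁).1 hpu hp

end Classification

/-! ### §2 Pay-off: HC for the Fermat `(p−1)`-folds of a degree with least prime `≥ p` -/

/-- **HC FOR EVERY SMOOTH PROJECTIVE COMPLEX FERMAT `(p₁−1)`-FOLD `X^{p₁−1}ₘ` OF A DEGREE `m` ALL OF WHOSE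
PRIME FACTORS ARE `≥ p₁`, WITH `p₁² ∤ m`, `p₁(p₁+2) ∤ m`** (`p₁ ≥ 5` prime), granted the named facts
Aoki 1987 Thm 1-4 (i) `hJ`, (ii) `hC`, Thm 1-1 `hP`, Thm 2-1 `hS`, Aoki–Shioda 1983 (2.1) `hNS`, and the
statements of the stubs S2↑ `hPull`, S2↓ `hPush`, S3a `h3a`, S5 `h5` (exactly the hypotheses of
`hodgeConjectureFor_fourfold_coprime_six` and of every earlier pay-off of the line): writing
`p₁ = 2r + 1`, every Hodge character `α` of `X²ʳₘ` has `2r + 2 = p₁ + 1` entries, so its value multiset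
is reachable at level `m` (`reach_general`), hence claimed (`Doubling.claimMultiset_of_stableReach`), and
the per-dimension transfer `hodgeConjectureFor_of_claims_dim` at `(m, r)` applies. Instances: `p₁ = 5`
(fourfolds of degree prime to `6`, `25 ∤ m`, `35 ∤ m`), `p₁ = 7` (sixfolds of degree prime to `30`,
`49 ∤ m`), `p₁ = 11` (`X¹⁰ₘ`, `minFac m ≥ 11`, `121 ∤ m`, `143 ∤ m`), ….
[cite: Aoki1983, Thm. A′ (§7)] [cite: Aoki1987, Thm. 2-1 (p. 388)] [cite: Shioda1979PJA, §2 Thm. 1] -/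
theorem hodgeConjectureFor_general
    (hJ : Aoki1987_claim_juxtaposition) (hC : Aoki1987_claim_of_claim_juxtaposition_paired)
    (hP : Shioda_claim_paired) (hNS : AokiShioda1983_eigenline_le_neronSeveri) (hS : Aoki1987_claim_pStandard)
    (hPull : LevelClaimPull) (hPush : LevelClaimPush) (h3a : SemiClaim) (h5 : EigenStructure)
    {p₁ : ℕ} (hp₁ : p₁.Prime) (hp₁5 : 5 ≤ p₁) {m : ℕ} [NeZero m]
    (hmin : ∀ q ∈ m.primeFactors, p₁ ≤ q) (hsq : ¬ p₁ * p₁ ∣ m) (htwin : ¬ p₁ * (p₁ + 2) ∣ m)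
    ⦃X : SchemeOver ℂ⦄ (hF : IsFermatVariety (p₁ - 1) m X) (hX : IsSmoothProjective (p₁ - 1) X) :
    HodgeConjectureFor (p₁ - 1) X := by
  -- adapted from the lead's skeleton (`hodgeConjectureFor_general_of_stubs`)
  obtain ⟨r, hr⟩ : ∃ r, p₁ = 2 * r + 1 := hp₁.odd_of_ne_two (by omega)
  have hp1 : p₁ - 1 = 2 * r := by omega
  rw [hp1] at hF hX ⊢
  have hr0 : 0 < r := by omega
  refine hodgeConjectureFor_of_claims_dim (m := m) (p := r) hr0 (h5 m hr0).1 (h5 m hr0).2.1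
    (h5 m hr0).2.2 (fun α hα ↦ ?_) hF hX
  have hs : IsHodgeMultiset (univ.val.map α) := hα.isHodgeMultiset
  have hcard : Multiset.card (univ.val.map α) = p₁ + 1 := by rw [card_univ_val_map]; omega
  have hs0 : univ.val.map α ≠ 0 := fun h0 ↦ by
    have h := congrArg Multiset.card h0
    rw [hcard, Multiset.card_zero] at h
    omega
  have hR : Reach[m, univ.val.map α] := reach_general hp₁ hp₁5 hmin hsq htwin hs hcard
  exact (claimMultiset_univ_val_map_iff α).1
    (Doubling.claimMultiset_of_stableReach hJ hC hP hNS hS hPull hPush h3a hs0 hs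
      (Doubling.stableReach_of_reach hR))

end Summit.HodgeConjecture.HodgeConjecture.Theorems.CancelByAnyClaimLattice.CoprimeSix

end
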